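import Summits.NavierStokesRegularity.NavierStokesRegularity.Theorems.CircuitPump.Negative.WitnessStructure

/-!
# `CircuitPump` (stmt-NavierStokesRegularity-1834): scalar (m = 1) witnesses are sign-definite

Negative-side structure lemma for the crux `PerpetualPump.CircuitPump` (cdisprove seat, work file
`Cruxes/CircuitPump/Disproof.lean` §(e2)). By `scalar_coeff_iff` the one-mode circuit is the signed
Katz–Pavlović chain `Ẋ_n = -lam^{4n/5}X_n + 2a(lam^nX_nX_{n+1} - lam^{n-1}X_{n-1}²)`. For `a < 0` (the KP
orientation; `a > 0` is the mirror image `X ↦ -X`, `a = 0` is dead by `no_free_mode`) every solution on `(-∞,0)`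
with the Type-I bound is NON-NEGATIVE: `scalar_nonneg`. So the m = 1 sub-question of the crux is a question about
non-negative, infinite-energy ancient solutions of the dyadic model — Barbato–Morandin–Romito's setting, but
ancient. Mechanism: write mode `n` as `Ẋ_n = g X_n + h` with `h = -2a lam^{n-1}X_{n-1}² ≥ 0` and
`g = -lam^{4n/5} + 2a lam^n X_{n+1}`; (i) far in the past Type I on `X_{n+1}` gives `g ≤ -½lam^{4n/5}`, so a
negative value of `X_n` could only grow in modulus towards the past (time-reversed fence), contradicting the
Type-I decay; (ii) from then on non-negativity propagates forward (an `ε`-fence for `-X_n e^{-Mt}`). Sorry-free.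
-/

set_option linter.dupNamespace false

noncomputable section

open scoped BigOperators
open Real Set

namespace Summit.NavierStokesRegularity.NavierStokesRegularity.Theorems.CircuitPumpNegative

/-- The scalar chain in product form: `Ẋ_n = g(t)·X_n + h(t)`, `g = -lam^{4n/5} + 2a lam^n X_{n+1}`,
`h = -2a lam^{n-1} X_{n-1}²`. -/
theorem scalar_hasDerivAt_gh {lam a : ℝ} (X : Fin 1 → ℤ → ℝ → ℝ) (hode : SolvesODE lam (scalarCoeff a) X)
    (n : ℤ) (t : ℝ) (ht : t < 0) :
    HasDerivAt (X 0 n)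
      ((-(lam ^ ((4 / 5 : ℝ) * n)) + 2 * a * lam ^ (n : ℝ) * X 0 (n + 1) t) * X 0 n t +
        (-(2 * a)) * lam ^ ((n : ℝ) - 1) * X 0 (n - 1) t ^ 2) t := by
  have h := hode 0 n t ht
  rw [scalar_rhs] at h
  refine h.congr_deriv ?_
  ring

/-- Unpacking Type I (local copy for the scalar file): `|X_{i,n}(t)| ≤ C·lam^{-3n/5}/√(-t)`. -/
theorem scalar_abs_le_of_typeI {lam : ℝ} (hlam : 1 < lam) {X : Fin 1 → ℤ → ℝ → ℝ} {C : ℝ}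
    (hTI : ∀ (i : Fin 1) (n : ℤ) (t : ℝ), t < 0 → lam ^ ((3 / 5 : ℝ) * n) * |X i n t| ≤ C / Real.sqrt (-t))
    (i : Fin 1) (n : ℤ) (t : ℝ) (ht : t < 0) :
    |X i n t| ≤ C * lam ^ (-((3 / 5 : ℝ) * n)) / Real.sqrt (-t) := by
  have hpos : 0 < lam := by linarith
  have hw : 0 < lam ^ ((3 / 5 : ℝ) * n) := Real.rpow_pos_of_pos hpos _
  have h := hTI i n t ht
  have hinv : lam ^ (-((3 / 5 : ℝ) * n)) = (lam ^ ((3 / 5 : ℝ) * n))⁻¹ := Real.rpow_neg hpos.le _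
  rw [hinv]
  rw [mul_comm] at h
  have := (le_div_iff₀ hw).2 h
  calc |X i n t| ≤ C / Real.sqrt (-t) / lam ^ ((3 / 5 : ℝ) * n) := this
    _ = C * (lam ^ ((3 / 5 : ℝ) * n))⁻¹ / Real.sqrt (-t) := by ring

/-- (i, time-reversed fence) In the far-past regime `g ≤ -½lam^{4n/5}` on `(-∞, t₁]`, a negative value
`X_n(t₁) < 0` can only be MORE negative earlier: `X_n(t₁ - s) ≤ X_n(t₁)` for all `s ≥ 0` (`a ≤ 0`). -/
theorem scalar_past_le {lam a : ℝ} (hlam : 1 < lam) (ha : a ≤ 0) (X : Fin 1 → ℤ → ℝ → ℝ)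
    (hode : SolvesODE lam (scalarCoeff a) X) (n : ℤ) (t₁ : ℝ) (ht₁ : t₁ < 0) (hneg : X 0 n t₁ < 0)
    (hg : ∀ τ : ℝ, τ ≤ t₁ →
      -(lam ^ ((4 / 5 : ℝ) * n)) + 2 * a * lam ^ (n : ℝ) * X 0 (n + 1) τ ≤ -(1 / 2) * lam ^ ((4 / 5 : ℝ) * n))
    (s : ℝ) (hs : 0 ≤ s) : X 0 n (t₁ - s) ≤ X 0 n t₁ := by
  have hpos : 0 < lam := by linarith
  have hrate : 0 < lam ^ ((4 / 5 : ℝ) * n) := Real.rpow_pos_of_pos hpos _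
  -- time reversal
  set Z : ℝ → ℝ := fun σ => X 0 n (t₁ - σ) with hZ
  set Z' : ℝ → ℝ := (fun σ => -((-(lam ^ ((4 / 5 : ℝ) * n)) + 2 * a * lam ^ (n : ℝ) * X 0 (n + 1) (t₁ - σ)) *
      X 0 n (t₁ - σ) + (-(2 * a)) * lam ^ ((n : ℝ) - 1) * X 0 (n - 1) (t₁ - σ) ^ 2)) with hZ'
  have hderiv : ∀ σ : ℝ, 0 ≤ σ → HasDerivAt Z (Z' σ) σ := by
    intro σ hσ
    have h1 := scalar_hasDerivAt_gh X hode n (t₁ - σ) (by linarith)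
    have h2 : HasDerivAt (fun σ : ℝ => t₁ - σ) (-1) σ := by
      simpa using (hasDerivAt_id σ).const_sub t₁
    have := h1.comp σ h2
    refine (this.congr_deriv ?_)
    simp only [hZ', mul_neg_one]
  -- fence with the constant barrier B ≡ Z 0 on [0, s]
  have hfc : ContinuousOn Z (Icc 0 s) := fun σ hσ => (hderiv σ hσ.1).continuousAt.continuousWithinAt
  have hf' : ∀ σ ∈ Ico 0 s, HasDerivWithinAt Z (Z' σ) (Ici σ) σ :=
    fun σ hσ => (hderiv σ hσ.1).hasDerivWithinAt
  have key := image_le_of_deriv_right_lt_deriv_boundary' hfc hf' (B := fun _ => Z 0) (B' := fun _ => 0)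
    (le_rfl) continuousOn_const (fun σ _ => (hasDerivAt_const σ _).hasDerivWithinAt) ?_ (right_mem_Icc.2 hs)
  · simpa [hZ] using key
  · intro σ hσ htouch
    -- at a touching point Z σ = Z 0 = X_n(t₁) < 0, and Z' σ = -(g Z + h) ≤ -g·Z ≤ ½lam^{4n/5}·Z < 0
    have hZσ : X 0 n (t₁ - σ) = X 0 n t₁ := by simpa [hZ] using htouch
    have hgσ := hg (t₁ - σ) (by linarith [hσ.1])
    have hh : 0 ≤ (-(2 * a)) * lam ^ ((n : ℝ) - 1) * X 0 (n - 1) (t₁ - σ) ^ 2 := by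
      have : 0 ≤ -(2 * a) := by linarith
      have : 0 ≤ lam ^ ((n : ℝ) - 1) := Real.rpow_nonneg hpos.le _
      positivity
    -- multiply `g ≤ -½R` by the negative number X_n(t₁): g·X_n(t₁) ≥ ½R|X_n(t₁)| > 0
    have hmul := mul_le_mul_of_nonpos_right hgσ hneg.le
    have hp : 0 < -(1 / 2) * lam ^ ((4 / 5 : ℝ) * n) * X 0 n t₁ := by
      have hx : 0 < -X 0 n t₁ := by linarith
      have : 0 < (1 / 2) * lam ^ ((4 / 5 : ℝ) * n) * (-X 0 n t₁) := by positivity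
      linarith
    show Z' σ < 0
    simp only [hZ']
    rw [hZσ]
    linarith [hmul, hh, hp]

/-- (i, conclusion) In the far-past regime the mode is non-negative: a negative value would persist and keep its
modulus towards the past (`scalar_past_le`), contradicting the Type-I decay. -/
theorem scalar_past_nonneg {lam a : ℝ} (hlam : 1 < lam) (ha : a ≤ 0) (X : Fin 1 → ℤ → ℝ → ℝ)
    (hode : SolvesODE lam (scalarCoeff a) X) {C : ℝ}
    (hTI : ∀ (i : Fin 1) (n : ℤ) (t : ℝ), t < 0 → lam ^ ((3 / 5 : ℝ) * n) * |X i n t| ≤ C / Real.sqrt (-t))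
    (n : ℤ) (t₁ : ℝ) (ht₁ : t₁ < 0)
    (hg : ∀ τ : ℝ, τ ≤ t₁ →
      -(lam ^ ((4 / 5 : ℝ) * n)) + 2 * a * lam ^ (n : ℝ) * X 0 (n + 1) τ ≤ -(1 / 2) * lam ^ ((4 / 5 : ℝ) * n)) :
    0 ≤ X 0 n t₁ := by
  have hpos : 0 < lam := by linarith
  by_contra hneg
  have hneg : X 0 n t₁ < 0 := not_le.1 hneg
  -- modulus bounded below in the past
  have hpast : ∀ s : ℝ, 0 ≤ s → |X 0 n t₁| ≤ |X 0 n (t₁ - s)| := by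
    intro s hs
    have h := scalar_past_le hlam ha X hode n t₁ ht₁ hneg hg s hs
    rw [abs_of_neg hneg, abs_of_neg (lt_of_le_of_lt h hneg)]
    linarith
  -- but Type I forces decay: pick s with C·lam^{-3n/5}/√(s - t₁) < |X_n(t₁)|
  obtain ⟨w, hw, hwpos⟩ : ∃ w : ℝ, w = lam ^ ((3 / 5 : ℝ) * n) ∧ 0 < w := ⟨_, rfl, Real.rpow_pos_of_pos hpos _⟩
  have hx : 0 < |X 0 n t₁| := abs_pos.2 hneg.ne
  set T : ℝ := max (1 - t₁) (((|C| + 1) / (w * |X 0 n t₁|)) ^ 2) with hT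
  have hT1 : 1 - t₁ ≤ T := le_max_left _ _
  have h2 := hpast (t₁ + T) (by linarith)
  have ht : t₁ - (t₁ + T) = -T := by ring
  rw [ht] at h2
  have hbound := hTI 0 n (-T) (by linarith)
  rw [neg_neg, ← hw] at hbound
  have hsq : (|C| + 1) / (w * |X 0 n t₁|) ≤ Real.sqrt T := by
    calc (|C| + 1) / (w * |X 0 n t₁|) = Real.sqrt (((|C| + 1) / (w * |X 0 n t₁|)) ^ 2) := by
          rw [Real.sqrt_sq (by positivity)]
      _ ≤ Real.sqrt T := Real.sqrt_le_sqrt (le_max_right _ _)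
  have hsqpos : 0 < Real.sqrt T := Real.sqrt_pos.2 (by linarith)
  have h3 : |C| + 1 ≤ w * |X 0 n t₁| * Real.sqrt T := by
    have := (div_le_iff₀ (by positivity : 0 < w * |X 0 n t₁|)).1 hsq
    linarith
  have h4 : w * |X 0 n (-T)| * Real.sqrt T ≤ C := by
    have := mul_le_mul_of_nonneg_right hbound hsqpos.le
    rwa [div_mul_cancel₀ C hsqpos.ne'] at this
  have h5 : w * |X 0 n t₁| * Real.sqrt T ≤ w * |X 0 n (-T)| * Real.sqrt T :=
    mul_le_mul_of_nonneg_right (mul_le_mul_of_nonneg_left h2 hwpos.le) hsqpos.le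
  linarith [le_abs_self C]


/-- (ii, forward ε-fence) Non-negativity propagates forward: if `X_n(t₂) ≥ 0` then `X_n(t) ≥ 0` for
`t₂ ≤ t < 0` (`a ≤ 0`; the linear coefficient `g` is bounded above on `[t₂, t]` by Type I on `X_{n+1}`). -/
theorem scalar_forward_nonneg {lam a : ℝ} (hlam : 1 < lam) (ha : a ≤ 0) (X : Fin 1 → ℤ → ℝ → ℝ)
    (hode : SolvesODE lam (scalarCoeff a) X) {C : ℝ}
    (hTI : ∀ (i : Fin 1) (n : ℤ) (t : ℝ), t < 0 → lam ^ ((3 / 5 : ℝ) * n) * |X i n t| ≤ C / Real.sqrt (-t))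
    (n : ℤ) (t₂ t : ℝ) (ht₂t : t₂ ≤ t) (ht : t < 0) (h₂ : 0 ≤ X 0 n t₂) : 0 ≤ X 0 n t := by
  have hpos : 0 < lam := by linarith
  have hnt : 0 < -t := by linarith
  have hC : 0 ≤ C := by
    have h := hTI 0 0 (-1) (by norm_num)
    have h1 : 0 ≤ lam ^ ((3 / 5 : ℝ) * ((0 : ℤ) : ℝ)) * |X 0 0 (-1)| :=
      mul_nonneg (Real.rpow_nonneg hpos.le _) (abs_nonneg _)
    have : (0 : ℝ) ≤ C / Real.sqrt (-(-1 : ℝ)) := h1.trans h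
    simpa using this
  -- an explicit upper bound M ≥ g on [t₂, t]
  obtain ⟨M, hM, hMnn⟩ : ∃ M : ℝ,
      M = |2 * a| * lam ^ (n : ℝ) * (C * lam ^ (-((3 / 5 : ℝ) * ((n + 1 : ℤ) : ℝ))) / Real.sqrt (-t)) ∧ 0 ≤ M :=
    ⟨_, rfl, by
      have : 0 ≤ lam ^ (n : ℝ) := Real.rpow_nonneg hpos.le _
      have : 0 ≤ lam ^ (-((3 / 5 : ℝ) * ((n + 1 : ℤ) : ℝ))) := Real.rpow_nonneg hpos.le _
      have : 0 ≤ Real.sqrt (-t) := Real.sqrt_nonneg _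
      positivity⟩
  have hg : ∀ τ : ℝ, t₂ ≤ τ → τ ≤ t →
      -(lam ^ ((4 / 5 : ℝ) * n)) + 2 * a * lam ^ (n : ℝ) * X 0 (n + 1) τ ≤ M := by
    intro τ _ hτt
    have hτ : τ < 0 := lt_of_le_of_lt hτt ht
    have hX := scalar_abs_le_of_typeI hlam hTI 0 (n + 1) τ hτ
    have hsq : Real.sqrt (-t) ≤ Real.sqrt (-τ) := Real.sqrt_le_sqrt (by linarith)
    have hsqt : 0 < Real.sqrt (-t) := Real.sqrt_pos.2 hnt
    have hnum : 0 ≤ C * lam ^ (-((3 / 5 : ℝ) * ((n + 1 : ℤ) : ℝ))) := by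
      have : 0 ≤ lam ^ (-((3 / 5 : ℝ) * ((n + 1 : ℤ) : ℝ))) := Real.rpow_nonneg hpos.le _
      positivity
    have hX' : |X 0 (n + 1) τ| ≤ C * lam ^ (-((3 / 5 : ℝ) * ((n + 1 : ℤ) : ℝ))) / Real.sqrt (-t) :=
      hX.trans (div_le_div_of_nonneg_left hnum hsqt hsq)
    have hR : 0 ≤ lam ^ ((4 / 5 : ℝ) * n) := Real.rpow_nonneg hpos.le _
    have hln : 0 ≤ lam ^ (n : ℝ) := Real.rpow_nonneg hpos.le _
    calc -(lam ^ ((4 / 5 : ℝ) * n)) + 2 * a * lam ^ (n : ℝ) * X 0 (n + 1) τ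
        ≤ 2 * a * lam ^ (n : ℝ) * X 0 (n + 1) τ := by linarith
      _ ≤ |2 * a * lam ^ (n : ℝ) * X 0 (n + 1) τ| := le_abs_self _
      _ = |2 * a| * lam ^ (n : ℝ) * |X 0 (n + 1) τ| := by rw [abs_mul, abs_mul, abs_of_nonneg hln]
      _ ≤ |2 * a| * lam ^ (n : ℝ) * (C * lam ^ (-((3 / 5 : ℝ) * ((n + 1 : ℤ) : ℝ))) / Real.sqrt (-t)) :=
          mul_le_mul_of_nonneg_left hX' (by positivity)
      _ = M := hM.symm
  -- the ε-fence for f = -X_n e^{-Mτ}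
  set f : ℝ → ℝ := fun τ => -X 0 n τ * Real.exp (-(M * τ)) with hf
  set f' : ℝ → ℝ := fun τ => Real.exp (-(M * τ)) *
      ((M - (-(lam ^ ((4 / 5 : ℝ) * n)) + 2 * a * lam ^ (n : ℝ) * X 0 (n + 1) τ)) * X 0 n τ -
        (-(2 * a)) * lam ^ ((n : ℝ) - 1) * X 0 (n - 1) τ ^ 2) with hf'
  have hderiv : ∀ τ : ℝ, τ < 0 → HasDerivAt f (f' τ) τ := by
    intro τ hτ
    have h1 := scalar_hasDerivAt_gh X hode n τ hτ
    have h2 : HasDerivAt (fun σ : ℝ => Real.exp (-(M * σ))) (Real.exp (-(M * τ)) * (-(M * 1))) τ :=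
      ((hasDerivAt_id τ).const_mul M).neg.exp
    have h3 := (h1.neg).mul h2
    refine h3.congr_deriv ?_
    simp only [hf', Pi.neg_apply]
    ring
  have key : ∀ ε : ℝ, 0 < ε → f t ≤ ε * (t - t₂ + 1) := by
    intro ε hε
    have hfc : ContinuousOn f (Icc t₂ t) :=
      fun τ hτ => (hderiv τ (lt_of_le_of_lt hτ.2 ht)).continuousAt.continuousWithinAt
    have hfd : ∀ τ ∈ Ico t₂ t, HasDerivWithinAt f (f' τ) (Ici τ) τ :=
      fun τ hτ => (hderiv τ (lt_trans hτ.2 ht)).hasDerivWithinAt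
    have hB : ∀ τ : ℝ, HasDerivAt (fun σ : ℝ => ε * (σ - t₂ + 1)) ε τ := by
      intro τ
      have := ((hasDerivAt_id τ).sub_const t₂).add_const 1 |>.const_mul ε
      simpa using this
    have ha0 : f t₂ ≤ ε * (t₂ - t₂ + 1) := by
      have : f t₂ ≤ 0 := by
        simp only [hf]
        have := Real.exp_pos (-(M * t₂))
        nlinarith
      linarith
    refine image_le_of_deriv_right_lt_deriv_boundary' hfc hfd ha0 (fun τ _ => (hB τ).continuousAt.continuousWithinAt)
      (fun τ _ => (hB τ).hasDerivWithinAt) ?_ (right_mem_Icc.2 ht₂t)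
    intro τ hτ htouch
    -- touching: f τ = ε(τ - t₂ + 1) > 0 ⇒ X_n(τ) < 0 ⇒ f' τ ≤ 0 < ε
    have hτneg : τ < 0 := lt_trans hτ.2 ht
    have hBpos : 0 < ε * (τ - t₂ + 1) := mul_pos hε (by linarith [hτ.1])
    have hexp : 0 < Real.exp (-(M * τ)) := Real.exp_pos _
    have hXneg : X 0 n τ < 0 := by
      rw [← htouch] at hBpos
      simp only [hf] at hBpos
      nlinarith
    have hgτ := hg τ hτ.1 hτ.2.le
    have hh : 0 ≤ (-(2 * a)) * lam ^ ((n : ℝ) - 1) * X 0 (n - 1) τ ^ 2 := by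
      have : 0 ≤ -(2 * a) := by linarith
      have : 0 ≤ lam ^ ((n : ℝ) - 1) := Real.rpow_nonneg hpos.le _
      positivity
    have hlin : (M - (-(lam ^ ((4 / 5 : ℝ) * n)) + 2 * a * lam ^ (n : ℝ) * X 0 (n + 1) τ)) * X 0 n τ ≤ 0 :=
      mul_nonpos_of_nonneg_of_nonpos (by linarith) hXneg.le
    have : f' τ ≤ 0 := by
      simp only [hf']
      exact mul_nonpos_of_nonneg_of_nonpos hexp.le (by linarith)
    linarith
  -- ε → 0
  have hft : f t ≤ 0 := by
    by_contra hcon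
    have hcon : 0 < f t := not_le.1 hcon
    have hK : 0 < t - t₂ + 1 := by linarith
    have := key (f t / (2 * (t - t₂ + 1))) (by positivity)
    have h2 : f t / (2 * (t - t₂ + 1)) * (t - t₂ + 1) = f t / 2 := by field_simp
    linarith
  have hexp : 0 < Real.exp (-(M * t)) := Real.exp_pos _
  simp only [hf] at hft
  nlinarith

/-- The far-past regime of mode `n`: for `τ ≤ -T_n` Type I on `X_{n+1}` gives `g(τ) ≤ -½lam^{4n/5}`. -/
theorem scalar_regime {lam a : ℝ} (hlam : 1 < lam) (X : Fin 1 → ℤ → ℝ → ℝ) {C : ℝ}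
    (hTI : ∀ (i : Fin 1) (n : ℤ) (t : ℝ), t < 0 → lam ^ ((3 / 5 : ℝ) * n) * |X i n t| ≤ C / Real.sqrt (-t))
    (n : ℤ) : ∃ T : ℝ, 1 ≤ T ∧ ∀ τ : ℝ, τ ≤ -T →
      -(lam ^ ((4 / 5 : ℝ) * n)) + 2 * a * lam ^ (n : ℝ) * X 0 (n + 1) τ ≤ -(1 / 2) * lam ^ ((4 / 5 : ℝ) * n) := by
  have hpos : 0 < lam := by linarith
  have hC : 0 ≤ C := by
    have h := hTI 0 0 (-1) (by norm_num)
    have h1 : 0 ≤ lam ^ ((3 / 5 : ℝ) * ((0 : ℤ) : ℝ)) * |X 0 0 (-1)| :=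
      mul_nonneg (Real.rpow_nonneg hpos.le _) (abs_nonneg _)
    have : (0 : ℝ) ≤ C / Real.sqrt (-(-1 : ℝ)) := h1.trans h
    simpa using this
  obtain ⟨R, hR, hRpos⟩ : ∃ R : ℝ, R = lam ^ ((4 / 5 : ℝ) * n) ∧ 0 < R := ⟨_, rfl, Real.rpow_pos_of_pos hpos _⟩
  obtain ⟨E, hE, hEnn⟩ : ∃ E : ℝ, E = |2 * a| * lam ^ (n : ℝ) * (C * lam ^ (-((3 / 5 : ℝ) * ((n + 1 : ℤ) : ℝ)))) ∧ 0 ≤ E :=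
    ⟨_, rfl, by
      have : 0 ≤ lam ^ (n : ℝ) := Real.rpow_nonneg hpos.le _
      have : 0 ≤ lam ^ (-((3 / 5 : ℝ) * ((n + 1 : ℤ) : ℝ))) := Real.rpow_nonneg hpos.le _
      positivity⟩
  refine ⟨(2 * E / R) ^ 2 + 1, by nlinarith [sq_nonneg (2 * E / R)], fun τ hτ => ?_⟩
  rw [← hR]
  have hτneg : τ < 0 := by nlinarith [sq_nonneg (2 * E / R)]
  have hnτ : 0 < -τ := by linarith
  have hsq : 2 * E / R ≤ Real.sqrt (-τ) := by
    have h1 : (2 * E / R) ^ 2 ≤ -τ := by linarith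
    calc 2 * E / R = Real.sqrt ((2 * E / R) ^ 2) := by rw [Real.sqrt_sq (by positivity)]
      _ ≤ Real.sqrt (-τ) := Real.sqrt_le_sqrt h1
  have hsqpos : 0 < Real.sqrt (-τ) := Real.sqrt_pos.2 hnτ
  have hX := scalar_abs_le_of_typeI hlam hTI 0 (n + 1) τ hτneg
  have hln : 0 ≤ lam ^ (n : ℝ) := Real.rpow_nonneg hpos.le _
  -- 2a lam^n X_{n+1} ≤ E/√(-τ) ≤ R/2
  have h1 : 2 * a * lam ^ (n : ℝ) * X 0 (n + 1) τ ≤ E / Real.sqrt (-τ) := by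
    calc 2 * a * lam ^ (n : ℝ) * X 0 (n + 1) τ ≤ |2 * a * lam ^ (n : ℝ) * X 0 (n + 1) τ| := le_abs_self _
      _ = |2 * a| * lam ^ (n : ℝ) * |X 0 (n + 1) τ| := by rw [abs_mul, abs_mul, abs_of_nonneg hln]
      _ ≤ |2 * a| * lam ^ (n : ℝ) * (C * lam ^ (-((3 / 5 : ℝ) * ((n + 1 : ℤ) : ℝ))) / Real.sqrt (-τ)) :=
          mul_le_mul_of_nonneg_left hX (by positivity)
      _ = E / Real.sqrt (-τ) := by rw [hE]; ring
  have h2 : E / Real.sqrt (-τ) ≤ R / 2 := by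
    rw [div_le_iff₀ hsqpos]
    have := mul_le_mul_of_nonneg_left hsq (by linarith : 0 ≤ R / 2)
    have h3 : R / 2 * (2 * E / R) = E := by field_simp
    linarith
  linarith

/-- **SCALAR WITNESSES ARE SIGN-DEFINITE.** For the one-mode circuit (`scalarCoeff a`, `a ≤ 0`: the
Katz–Pavlović orientation; `a ≥ 0` is its mirror image `X ↦ -X`), every solution on `(-∞,0)` with the Type-I bound
is non-negative: `0 ≤ X_{0,n}(t)` for all `n` and all `t < 0`. (Work file `Cruxes/CircuitPump/Disproof.lean` §(e2).)
Hence an m = 1 witness of the crux is a NON-NEGATIVE infinite-energy ancient solution of the dyadic model. -/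
theorem scalar_nonneg {lam a : ℝ} (hlam : 1 < lam) (ha : a ≤ 0) (X : Fin 1 → ℤ → ℝ → ℝ)
    (hode : SolvesODE lam (scalarCoeff a) X) (hTI : IsTypeI lam X) (n : ℤ) (t : ℝ) (ht : t < 0) :
    0 ≤ X 0 n t := by
  obtain ⟨C, hC⟩ := hTI
  obtain ⟨T, hT1, hreg⟩ := scalar_regime (a := a) hlam X hC n
  -- t₂ := min t (-T) is in the far-past regime
  have ht₂neg : min t (-T) < 0 := lt_of_le_of_lt (min_le_left _ _) ht
  have hreg₂ : ∀ τ : ℝ, τ ≤ min t (-T) →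
      -(lam ^ ((4 / 5 : ℝ) * n)) + 2 * a * lam ^ (n : ℝ) * X 0 (n + 1) τ ≤ -(1 / 2) * lam ^ ((4 / 5 : ℝ) * n) :=
    fun τ hτ => hreg τ (hτ.trans (min_le_right _ _))
  have h₂ : 0 ≤ X 0 n (min t (-T)) := scalar_past_nonneg hlam ha X hode hC n _ ht₂neg hreg₂
  exact scalar_forward_nonneg hlam ha X hode hC n _ t (min_le_left _ _) ht h₂

end Summit.NavierStokesRegularity.NavierStokesRegularity.Theorems.CircuitPumpNegative
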